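import Literature.Barriers.NavierStokesRegularity.HypodissipativeLerayNonuniquenessCDLDRScheme
import Literature.Analysis.FluidPDE.FractionalNSPrescribedEnergyIterationAssembly
import HarnessLib

/-!
# Colombo–De Lellis–De Rosa 2018, Thms. 1.2–1.3 from the one-step perturbation construction

Fifth sibling proof file (theorems only, no definitions, no notation) of the barrier entry
`Literature/Barriers/NavierStokesRegularity/HypodissipativeLerayNonuniqueness` (D-0021). The
sibling `HypodissipativeLerayNonuniquenessCDLDRScheme` reduces Thm. 1.2 (infinitely many Leray
solutions of the hypodissipative Navier–Stokes system from one `L²` datum, `α < 1/5`;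
`ColomboDeLellisDeRosa2018_thm12`) and Thm. 1.3 to the iteration Prop. 3.2 of the source
(`Literature.Analysis.FluidPDE.ColomboDeLellisDeRosa2018_prop32`); the Analysis/FluidPDE file
`FractionalNSPrescribedEnergyIterationAssembly` proves Prop. 3.2 from Lemma 3.1 (proved,
`FractionalNSStartingTripleBounds`) and the one-step construction of §4 with the estimates of
§§5–8.2 (the hypothesis predicate `CDLDR.StepSpec`). Composing, the theorems of Colombo–De Lellis–
De Rosa rest on that single step:

* `ColomboDeLellisDeRosa2018_thm13_of_stepSpec` — Thm. 1.3 from the inductive step;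
* `ColomboDeLellisDeRosa2018_thm12_of_stepSpec` — Thm. 1.2 from the inductive step (Thm. 1.1,
  Cor. 11.2, Lemma 3.1, the bookkeeping (43), the passage to the limit, Prop. 2.2 ⇐ Prop. 3.2,
  Thm. 1.3 ⇐ Prop. 2.2 and the continuation/gluing Thm. 1.2 ⇐ Thm. 1.3 + Thm. 1.1 all being proved
  in the tree).

## References

* M. Colombo, C. De Lellis, L. De Rosa, *Ill-posedness of Leray solutions for the hypodissipative
  Navier–Stokes equations*, Comm. Math. Phys. 362 (2018), 659–688 (held: arXiv:1708.05666): §1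
  Thms. 1.2–1.3; §3 Lemma 3.1, Prop. 3.2; §4; §8.2–8.3. [`ColomboDelellisDerosa2018`]
-/

noncomputable section

open Literature.Analysis.FluidPDE

namespace Literature.Barriers.NavierStokesRegularity

/-- **Colombo–De Lellis–De Rosa 2018, Thm. 1.3 from the one-step construction** (§4 with the
estimates of §§5–8.2, the hypothesis predicate `CDLDR.StepSpec`, in some normalisation window for
each `α ∈ (0, 1/5)`): `ColomboDeLellisDeRosa2018_thm13_of_prop32` composed with the proved
induction `ColomboDeLellisDeRosa2018_prop32_of_stepSpec`.
[cite: ColomboDelellisDerosa2018, §8.2 (proof of Prop. 3.2), §8.3, §2 (proof of Thm. 1.3)] -/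
theorem ColomboDeLellisDeRosa2018_thm13_of_stepSpec
    (hstep : ∀ α : ℝ, 0 < α → α < 1 / 5 → ∃ c₀ T₀ M η C₁ : ℝ,
      0 < c₀ ∧ c₀ ≤ 1 ∧ 0 < T₀ ∧ 1 ≤ M ∧ 0 < η ∧ 0 ≤ C₁ ∧ CDLDR.StepSpec α c₀ T₀ M η C₁) :
    ColomboDeLellisDeRosa2018_thm13 :=
  ColomboDeLellisDeRosa2018_thm13_of_prop32 (ColomboDeLellisDeRosa2018_prop32_of_stepSpec hstep)

/-- **Colombo–De Lellis–De Rosa 2018, Thm. 1.2 from the one-step construction**: for `α < 1/5`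
some divergence-free `v̄ ∈ L²(𝕋³)` carries infinitely many Leray solutions
(`ColomboDeLellisDeRosa2018_thm12`), GIVEN only the inductive step of the convex-integration
scheme (`CDLDR.StepSpec`); every other ingredient of the printed proof is a theorem of the tree.
[cite: ColomboDelellisDerosa2018, §1 p. 3, §2 pp. 5–6, §3, §8.2–8.3] -/
theorem ColomboDeLellisDeRosa2018_thm12_of_stepSpec
    (hstep : ∀ α : ℝ, 0 < α → α < 1 / 5 → ∃ c₀ T₀ M η C₁ : ℝ,
      0 < c₀ ∧ c₀ ≤ 1 ∧ 0 < T₀ ∧ 1 ≤ M ∧ 0 < η ∧ 0 ≤ C₁ ∧ CDLDR.StepSpec α c₀ T₀ M η C₁) :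
    ColomboDeLellisDeRosa2018_thm12 :=
  ColomboDeLellisDeRosa2018_thm12_of_prop32 (ColomboDeLellisDeRosa2018_prop32_of_stepSpec hstep)

end Literature.Barriers.NavierStokesRegularity
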